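import Literature.Probability.Distributions.BrascampLiebVarianceInequality
import Literature.Probability.Distributions.BrascampLiebConvex
import Literature.Probability.Distributions.BrascampLiebMatrix
import Literature.Probability.Distributions.BrascampLiebLinAlg
import HarnessLib

/-!
# Brascamp–Lieb for linear observables under a quadratic floor on the Hessian

Support file for crux `BirComplexStableXYR` (stmt-HubbardSuperconductivity-14845) of route
`BalabanIR`, idea card `log-concave-core-bounded-phase` (step (c): "the Gaussian-regime half of
conjunct 2 is Brascamp–Lieb").  The tree's Brascamp–Lieb Theorem 4.1
(`Literature.Probability.Distributions.bl_wholeSpace_raw`, `BrascampLieb1976_thm41_holds`) bounds the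
variance of `h` under `e^{-f}dx` by `∫ ∇hᵀ (f_xx)⁻¹ ∇h e^{-f}`.  For a LINEAR observable
`h(x) = a·x` and a potential whose second derivative dominates a fixed positive definite quadratic
form `q` (`q(v) ≤ D²f(x)(v,v)` for all `x, v`), the right side is at most `σ ∫ e^{-f}` as soon as
`2 a·v - q(v) ≤ σ` for every `v` (variational form of `aᵀ q⁻¹ a ≤ σ`): no matrix inverse, no
smallest eigenvalue — this is the form in which the effective-resistance bound of
`BalabanIRBirComplexStableXYRResistance` enters.  We also record the transfer of the Hessian floor
from explicit line derivatives (`sndDeriv_line_eq`).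

No new definitions; fully proved, standard axioms.
-/

noncomputable section

namespace Summit.HubbardSuperconductivity.HubbardSuperconductivity.Theorems

namespace LinearBL

open MeasureTheory Matrix Filter Set
open Literature.Probability.Distributions
open Literature.Probability.Distributions.BrascampLiebCalculus (posDef_coordHessian_iff
  hasDerivAt_line_fderiv)
open Literature.Probability.Distributions.BrascampLiebMatrix (dotProduct_inv_mulVec_eq
  dotProduct_inv_mulVec_nonneg)
open scoped Topology

variable {N : ℕ}

/-! ### Linear observables -/

/-- The linear observable `x ↦ a·x` as a continuous linear map. [folklore] -/
theorem dotProduct_eq_clm (a : Fin N → ℝ) :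
    (fun x : Fin N → ℝ => a ⬝ᵥ x) =
      fun x => (∑ i, a i • ContinuousLinearMap.proj (R := ℝ) (φ := fun _ : Fin N => ℝ) i) x := by
  funext x
  simp [dotProduct, smul_eq_mul]

/-- `x ↦ a·x` is `C^∞` (in particular `C¹`). [folklore] -/
theorem contDiff_dotProduct (a : Fin N → ℝ) {n : WithTop ℕ∞} :
    ContDiff ℝ n (fun x : Fin N → ℝ => a ⬝ᵥ x) := by
  rw [dotProduct_eq_clm a]
  exact (∑ i, a i • ContinuousLinearMap.proj (R := ℝ) (φ := fun _ : Fin N => ℝ) i).contDiff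

/-- The Fréchet derivative of `x ↦ a·x` is `v ↦ a·v`. [folklore] -/
theorem fderiv_dotProduct_apply (a x v : Fin N → ℝ) :
    fderiv ℝ (fun y : Fin N → ℝ => a ⬝ᵥ y) x v = a ⬝ᵥ v := by
  rw [dotProduct_eq_clm a, ContinuousLinearMap.fderiv]
  simp [dotProduct, smul_eq_mul]

/-- The coordinate gradient of `x ↦ a·x` is the constant vector `a`. [folklore] -/
theorem coordGradient_dotProduct (a x : Fin N → ℝ) :
    coordGradient (fun y : Fin N → ℝ => a ⬝ᵥ y) x = a := by
  funext i
  simp only [coordGradient, fderiv_dotProduct_apply]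
  simp [dotProduct, Pi.single_apply]

/-- Polynomial bound `|a·x| ≤ (Σ|aᵢ|)(1 + ‖x‖)`. [folklore] -/
theorem abs_dotProduct_le (a x : Fin N → ℝ) :
    |a ⬝ᵥ x| ≤ (∑ i, |a i|) * (1 + ‖x‖) ^ 1 := by
  rw [pow_one, dotProduct]
  calc |∑ i, a i * x i| ≤ ∑ i, |a i * x i| := Finset.abs_sum_le_sum_abs _ _
    _ = ∑ i, |a i| * |x i| := by simp_rw [abs_mul]
    _ ≤ ∑ i, |a i| * (1 + ‖x‖) := Finset.sum_le_sum fun i _ =>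
        mul_le_mul_of_nonneg_left (by
          have : |x i| ≤ ‖x‖ := by rw [← Real.norm_eq_abs]; exact norm_le_pi_norm x i
          linarith) (abs_nonneg _)
    _ = (∑ i, |a i|) * (1 + ‖x‖) := by rw [Finset.sum_mul]

/-- Polynomial bound `(a·x)² ≤ (Σ|aᵢ|)²(1 + ‖x‖)²`. [folklore] -/
theorem sq_dotProduct_le (a x : Fin N → ℝ) :
    |(a ⬝ᵥ x) ^ 2| ≤ (∑ i, |a i|) ^ 2 * (1 + ‖x‖) ^ 2 := by
  rw [abs_of_nonneg (sq_nonneg _), ← mul_pow, ← sq_abs]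
  have h := abs_dotProduct_le a x
  rw [pow_one] at h
  exact pow_le_pow_left₀ (abs_nonneg _) h 2

/-! ### The Hessian floor -/

/-- **Line derivatives identify the second Fréchet derivative on the diagonal.**  If along the
line `t ↦ x + t v` the `C²` function `f` has derivative `g` and `g` has derivative `g'₀` at `0`,
then `D²f(x)(v,v) = g'₀`. [folklore] -/
theorem sndDeriv_line_eq {f : (Fin N → ℝ) → ℝ} (hf : ContDiff ℝ 2 f) (x v : Fin N → ℝ)
    {g : ℝ → ℝ} {g'₀ : ℝ} (hg : ∀ s, HasDerivAt (fun t : ℝ => f (x + t • v)) (g s) s)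
    (hg' : HasDerivAt g g'₀ 0) :
    fderiv ℝ (fderiv ℝ f) x v v = g'₀ := by
  have hd : Differentiable ℝ f := hf.differentiable two_ne_zero
  have h1 : (fun s : ℝ => fderiv ℝ f (x + s • v) v) = g := by
    funext s
    exact (hasDerivAt_line hd x v s).unique (hg s)
  have h2 := hasDerivAt_line_fderiv hf x v 0
  rw [h1, zero_smul, add_zero] at h2
  exact h2.unique hg'

/-- A quadratic floor `q ≤ D²f` with `q > 0` off the origin makes every coordinate Hessian
positive definite. [folklore] -/
theorem posDef_coordHessian_of_floor {f : (Fin N → ℝ) → ℝ} (hf : ContDiff ℝ 2 f)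
    {q : (Fin N → ℝ) → ℝ} (hq : ∀ x v, q v ≤ fderiv ℝ (fderiv ℝ f) x v v)
    (hqpos : ∀ v, v ≠ 0 → 0 < q v) (x : Fin N → ℝ) :
    (coordHessian f x).PosDef :=
  (posDef_coordHessian_iff hf x).2 fun v hv => (hqpos v hv).trans_le (hq x v)

/-- **The Brascamp–Lieb quadratic form of a linear observable under a Hessian floor**:
`aᵀ (f_xx(x))⁻¹ a ≤ σ` whenever `q ≤ D²f(x)` and `2a·v - q(v) ≤ σ` for all `v`
(take `v = f_xx(x)⁻¹ a` in the variational identity `aᵀP⁻¹a = 2a·v - vᵀPv`). [folklore] -/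
theorem inv_quadForm_le_of_floor {f : (Fin N → ℝ) → ℝ} (hf : ContDiff ℝ 2 f)
    {q : (Fin N → ℝ) → ℝ} (hq : ∀ x v, q v ≤ fderiv ℝ (fderiv ℝ f) x v v)
    (hqpos : ∀ v, v ≠ 0 → 0 < q v) {a : Fin N → ℝ} {σ : ℝ}
    (hσ : ∀ v, 2 * (a ⬝ᵥ v) - q v ≤ σ) (x : Fin N → ℝ) :
    a ⬝ᵥ ((coordHessian f x)⁻¹ *ᵥ a) ≤ σ := by
  have hpd := posDef_coordHessian_of_floor hf hq hqpos x
  rw [dotProduct_inv_mulVec_eq hpd a]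
  set w := (coordHessian f x)⁻¹ *ᵥ a
  have hw : q w ≤ w ⬝ᵥ (coordHessian f x *ᵥ w) := by
    rw [BrascampLiebCalculus.dotProduct_coordHessian_mulVec hf]
    exact hq x w
  linarith [hσ w]

/-! ### The variance inequality on `Fin N → ℝ` -/

/-- **Brascamp–Lieb for a linear observable under a Hessian floor (coordinates `Fin N`).**
Let `f ∈ C²(ℝᴺ)` attain its minimum and satisfy `q(v) ≤ D²f(x)(v,v)` for a form `q` with
`q(v) > 0` for `v ≠ 0`; let `a ∈ ℝᴺ` and `σ` with `2a·v - q(v) ≤ σ` for all `v`.  Then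
`e^{-f}`, `(a·x)e^{-f}`, `(a·x)²e^{-f}` are integrable and
`(∫(a·x)²e^{-f})(∫e^{-f}) - (∫(a·x)e^{-f})² ≤ σ (∫e^{-f})²`, i.e. `Var_{e^{-f}}(a·x) ≤ σ`.
[cite: BrascampLieb1976, Thm 4.1] -/
theorem linearBL_fin {f : (Fin N → ℝ) → ℝ} (hf : ContDiff ℝ 2 f)
    {q : (Fin N → ℝ) → ℝ} (hq : ∀ x v, q v ≤ fderiv ℝ (fderiv ℝ f) x v v)
    (hqpos : ∀ v, v ≠ 0 → 0 < q v) (hmin : ∃ x₀, ∀ x, f x₀ ≤ f x)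
    (a : Fin N → ℝ) {σ : ℝ} (hσ : ∀ v, 2 * (a ⬝ᵥ v) - q v ≤ σ) :
    Integrable (fun x => Real.exp (-f x)) ∧
    Integrable (fun x => (a ⬝ᵥ x) * Real.exp (-f x)) ∧
    Integrable (fun x => (a ⬝ᵥ x) ^ 2 * Real.exp (-f x)) ∧
    (∫ x, (a ⬝ᵥ x) ^ 2 * Real.exp (-f x)) * (∫ x, Real.exp (-f x)) -
        (∫ x, (a ⬝ᵥ x) * Real.exp (-f x)) ^ 2 ≤ σ * (∫ x, Real.exp (-f x)) ^ 2 := by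
  obtain ⟨x₀, hx₀⟩ := hmin
  have hpd : ∀ x, (coordHessian f x).PosDef := posDef_coordHessian_of_floor hf hq hqpos
  -- growth and integrability
  obtain ⟨c, hc, C₀, hcoer⟩ := BrascampLiebConvex.exists_linear_lower_bound hf hpd hx₀
  have hZ : Integrable (fun x => Real.exp (-f x)) :=
    BrascampLiebMarginal.integrable_exp_neg hf.continuous hc hcoer
  have hA : Integrable (fun x => (a ⬝ᵥ x) * Real.exp (-f x)) := by
    have := BrascampLiebMarginal.integrable_exp_neg_mul (φ := fun x => a ⬝ᵥ x) hf.continuous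
      (contDiff_dotProduct a (n := 0)).continuous (K' := ∑ i, |a i|) (k' := 1)
      (abs_dotProduct_le a) hc hcoer
    simpa [mul_comm] using this
  have hB : Integrable (fun x => (a ⬝ᵥ x) ^ 2 * Real.exp (-f x)) := by
    have := BrascampLiebMarginal.integrable_exp_neg_mul (φ := fun x => (a ⬝ᵥ x) ^ 2) hf.continuous
      ((contDiff_dotProduct a (n := 0)).continuous.pow 2) (K' := (∑ i, |a i|) ^ 2) (k' := 2)
      (sq_dotProduct_le a) hc hcoer
    simpa [mul_comm] using this
  refine ⟨hZ, hA, hB, ?_⟩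
  -- the Brascamp–Lieb quadratic form of `h = a·x` is bounded by `σ`
  set Q : (Fin N → ℝ) → ℝ := fun x =>
    coordGradient (fun y : Fin N → ℝ => a ⬝ᵥ y) x ⬝ᵥ
      ((coordHessian f x)⁻¹ *ᵥ coordGradient (fun y : Fin N → ℝ => a ⬝ᵥ y) x) with hQdef
  have hQ : ∀ x, Q x = a ⬝ᵥ ((coordHessian f x)⁻¹ *ᵥ a) := fun x => by
    simp only [hQdef, coordGradient_dotProduct]
  have hQle : ∀ x, Q x ≤ σ := fun x => by rw [hQ]; exact inv_quadForm_le_of_floor hf hq hqpos hσ x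
  have hQnn : ∀ x, 0 ≤ Q x := fun x => by rw [hQ]; exact dotProduct_inv_mulVec_nonneg (hpd x) a
  have hQcont : Continuous Q := by
    have hinv : Continuous fun x => (coordHessian f x)⁻¹ :=
      continuous_matrix_inv_of_det_ne_zero (continuous_coordHessian hf)
        fun x => (hpd x).det_pos.ne'
    have hQfun : Q = fun x => a ⬝ᵥ ((coordHessian f x)⁻¹ *ᵥ a) := funext hQ
    rw [hQfun]
    exact continuous_const.dotProduct (hinv.matrix_mulVec continuous_const)
  have hQint : Integrable (fun x => Q x * Real.exp (-f x)) := by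
    refine (hZ.const_mul σ).mono' (hQcont.mul (by fun_prop)).aestronglyMeasurable
      (ae_of_all _ fun x => ?_)
    rw [Real.norm_eq_abs, abs_mul, abs_of_nonneg (hQnn x), abs_of_pos (Real.exp_pos _)]
    exact mul_le_mul_of_nonneg_right (hQle x) (Real.exp_pos _).le
  have hraw := bl_wholeSpace_raw hf hpd (contDiff_dotProduct a) hZ hA hB hQint
  have hZnn : 0 ≤ ∫ x, Real.exp (-f x) := integral_nonneg fun x => (Real.exp_pos _).le
  have hQI : (∫ x, Q x * Real.exp (-f x)) ≤ σ * ∫ x, Real.exp (-f x) := by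
    rw [← integral_const_mul]
    exact integral_mono hQint (hZ.const_mul σ) fun x =>
      mul_le_mul_of_nonneg_right (hQle x) (Real.exp_pos _).le
  calc (∫ x, (a ⬝ᵥ x) ^ 2 * Real.exp (-f x)) * (∫ x, Real.exp (-f x)) -
        (∫ x, (a ⬝ᵥ x) * Real.exp (-f x)) ^ 2
      ≤ (∫ x, Q x * Real.exp (-f x)) * (∫ x, Real.exp (-f x)) := hraw
    _ ≤ (σ * ∫ x, Real.exp (-f x)) * (∫ x, Real.exp (-f x)) :=
        mul_le_mul_of_nonneg_right hQI hZnn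
    _ = σ * (∫ x, Real.exp (-f x)) ^ 2 := by ring

/-! ### Relabelling: an arbitrary finite index type -/

/-- **Brascamp–Lieb for a linear observable under a Hessian floor (finite index type `ι`).**
Same statement as `linearBL_fin` on `ι → ℝ` for a finite index type, with the Hessian floor given
through LINE derivatives: for every `x, v` there are `g` (the derivative of `t ↦ f(x + t v)`) and
`g'₀` (the derivative of `g` at `0`) with `q(v) ≤ g'₀`.  Proof: relabel `ι ≃ Fin N`; Lebesgue
measure, lines and linear observables are transported verbatim. [cite: BrascampLieb1976, Thm 4.1] -/
theorem linearBL {ι : Type*} [Fintype ι] {f : (ι → ℝ) → ℝ} (hf : ContDiff ℝ 2 f)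
    {q : (ι → ℝ) → ℝ}
    (hline : ∀ x v : ι → ℝ, ∃ g : ℝ → ℝ, ∃ g'₀ : ℝ,
      (∀ s, HasDerivAt (fun t : ℝ => f (x + t • v)) (g s) s) ∧ HasDerivAt g g'₀ 0 ∧ q v ≤ g'₀)
    (hqpos : ∀ v, v ≠ 0 → 0 < q v) (hmin : ∃ x₀, ∀ x, f x₀ ≤ f x)
    (a : ι → ℝ) {σ : ℝ} (hσ : ∀ v, 2 * (a ⬝ᵥ v) - q v ≤ σ) :
    Integrable (fun x => Real.exp (-f x)) ∧
    Integrable (fun x => (a ⬝ᵥ x) * Real.exp (-f x)) ∧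
    Integrable (fun x => (a ⬝ᵥ x) ^ 2 * Real.exp (-f x)) ∧
    (∫ x, (a ⬝ᵥ x) ^ 2 * Real.exp (-f x)) * (∫ x, Real.exp (-f x)) -
        (∫ x, (a ⬝ᵥ x) * Real.exp (-f x)) ^ 2 ≤ σ * (∫ x, Real.exp (-f x)) ^ 2 := by
  classical
  set N := Fintype.card ι
  set e : ι ≃ Fin N := Fintype.equivFin ι with he
  -- the relabelling map and its measure-theoretic avatar
  set T : (Fin N → ℝ) → (ι → ℝ) := fun x i => x (e i) with hT
  set Φ : (Fin N → ℝ) ≃ᵐ (ι → ℝ) := MeasurableEquiv.piCongrLeft (fun _ : ι => ℝ) e.symm with hΦ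
  have hΦT : ∀ x, Φ x = T x := by
    intro x; funext i
    have h := Equiv.piCongrLeft_apply_apply (P := fun _ : ι => ℝ) e.symm x (e i)
    rw [Equiv.symm_apply_apply] at h
    rw [hΦ, MeasurableEquiv.coe_piCongrLeft]
    exact h
  have hmp : MeasurePreserving Φ volume volume :=
    volume_measurePreserving_piCongrLeft (fun _ : ι => ℝ) e.symm
  have hTlin : ∀ (x v : Fin N → ℝ) (t : ℝ), T (x + t • v) = T x + t • T v := by
    intro x v t; funext i; simp [hT]
  have hTcd : ContDiff ℝ 2 T := contDiff_pi.2 fun i => contDiff_apply ℝ ℝ (e i)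
  have hTsurj : ∀ y : ι → ℝ, T (fun j => y (e.symm j)) = y := by
    intro y; funext i; simp [hT]
  have hTinj : ∀ v : Fin N → ℝ, T v = 0 → v = 0 := by
    intro v hv; funext j
    have := congr_fun hv (e.symm j)
    simpa [hT] using this
  -- transported data
  set f' : (Fin N → ℝ) → ℝ := fun x => f (T x) with hf'
  set q' : (Fin N → ℝ) → ℝ := fun v => q (T v) with hq'
  set a' : Fin N → ℝ := fun j => a (e.symm j) with ha'
  have hdot : ∀ x : Fin N → ℝ, a' ⬝ᵥ x = a ⬝ᵥ T x := by
    intro x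
    simp only [dotProduct, ha', hT]
    exact (Fintype.sum_equiv e.symm _ _ fun j => by simp)
  have hf'cd : ContDiff ℝ 2 f' := hf.comp hTcd
  have hq'le : ∀ x v, q' v ≤ fderiv ℝ (fderiv ℝ f') x v v := by
    intro x v
    obtain ⟨g, g'₀, hg, hg', hqv⟩ := hline (T x) (T v)
    have hgx : ∀ s, HasDerivAt (fun t : ℝ => f' (x + t • v)) (g s) s := by
      intro s
      have : (fun t : ℝ => f' (x + t • v)) = fun t => f (T x + t • T v) := by
        funext t; simp only [hf', hTlin]
      rw [this]; exact hg s
    rw [sndDeriv_line_eq hf'cd x v hgx hg']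
    exact hqv
  have hq'pos : ∀ v, v ≠ 0 → 0 < q' v := fun v hv =>
    hqpos (T v) fun h0 => hv (hTinj v h0)
  have hmin' : ∃ x₀, ∀ x, f' x₀ ≤ f' x := by
    obtain ⟨x₀, hx₀⟩ := hmin
    exact ⟨fun j => x₀ (e.symm j), fun x => by simp only [hf', hTsurj]; exact hx₀ _⟩
  have hσ' : ∀ v, 2 * (a' ⬝ᵥ v) - q' v ≤ σ := fun v => by rw [hdot]; exact hσ (T v)
  obtain ⟨hZ, hA, hB, hV⟩ := linearBL_fin hf'cd hq'le hq'pos hmin' a' hσ'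
  -- transport back along `Φ = T`
  have eZ : (fun x => Real.exp (-f' x)) = (fun y : ι → ℝ => Real.exp (-f y)) ∘ Φ := by
    funext x; simp [hf', hΦT]
  have eA : (fun x => (a' ⬝ᵥ x) * Real.exp (-f' x)) =
      (fun y : ι → ℝ => (a ⬝ᵥ y) * Real.exp (-f y)) ∘ Φ := by
    funext x; simp [hf', hΦT, hdot]
  have eB : (fun x => (a' ⬝ᵥ x) ^ 2 * Real.exp (-f' x)) =
      (fun y : ι → ℝ => (a ⬝ᵥ y) ^ 2 * Real.exp (-f y)) ∘ Φ := by
    funext x; simp [hf', hΦT, hdot]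
  have iZ : (∫ x, Real.exp (-f' x)) = ∫ y : ι → ℝ, Real.exp (-f y) := by
    rw [eZ]; exact hmp.integral_comp' (fun y : ι → ℝ => Real.exp (-f y))
  have iA : (∫ x, (a' ⬝ᵥ x) * Real.exp (-f' x)) = ∫ y : ι → ℝ, (a ⬝ᵥ y) * Real.exp (-f y) := by
    rw [eA]; exact hmp.integral_comp' (fun y : ι → ℝ => (a ⬝ᵥ y) * Real.exp (-f y))
  have iB : (∫ x, (a' ⬝ᵥ x) ^ 2 * Real.exp (-f' x)) =
      ∫ y : ι → ℝ, (a ⬝ᵥ y) ^ 2 * Real.exp (-f y) := by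
    rw [eB]; exact hmp.integral_comp' (fun y : ι → ℝ => (a ⬝ᵥ y) ^ 2 * Real.exp (-f y))
  refine ⟨?_, ?_, ?_, ?_⟩
  · rw [eZ] at hZ; exact (hmp.integrable_comp_emb Φ.measurableEmbedding).1 hZ
  · rw [eA] at hA; exact (hmp.integrable_comp_emb Φ.measurableEmbedding).1 hA
  · rw [eB] at hB; exact (hmp.integrable_comp_emb Φ.measurableEmbedding).1 hB
  · rw [iZ, iA, iB] at hV; exact hV

end LinearBL

end Summit.HubbardSuperconductivity.HubbardSuperconductivity.Theorems
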